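import Mathlib.Combinatorics.SetFamily.FourFunctions
import Literature.Probability.LatticeModels.RandomClusterFKG
import HarnessLib

/-!
# Strong positive association of the random-cluster measure: conditional comparison, proved

Topic `Literature/Probability/LatticeModels` (trunk `StatMech`). For the finite-graph
random-cluster measure `φ = φ^B_{G,p,q} = rcMeasure G p q B` of the tree (`RandomCluster.lean`;
Grimmett 2006, (1.2), wired vertex set `B` as in §4.2) with `0 ≤ p ≤ 1` and `q ≥ 1` we prove the
consequences of the FKG *lattice condition* of its weights (`rcWeight_lattice_condition`,
Grimmett 2006, Thm. (3.8)(a)) that go beyond the plain FKG inequality `rcMeasure_fkg_holds`, in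
the form in which "successive conditioning and the comparison between boundary conditions"
(Duminil-Copin–Smirnov 2012, §3.2 Thm. 3.1 and §6.1) are used in finite volume:

* `rcMeasure_real_four_events` — the **four-events inequality**: if four events satisfy
  `ω₁ ∈ A₁, ω₂ ∈ A₂ ⇒ ω₁ ∩ ω₂ ∈ A₃, ω₁ ∪ ω₂ ∈ A₄`, then `φ(A₁) φ(A₂) ≤ φ(A₃) φ(A₄)`. This is the
  Ahlswede–Daykin four functions theorem (Mathlib `four_functions_theorem_univ`, on the finite
  distributive lattice `Finset (Sym2 V)` of edge sets) applied to the weighted indicators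
  `w · 1_{Aᵢ}`; every other statement of this file is a specialisation.
* `rcMeasure_real_cond_mono` — **`φ_{p,q}` is monotonic** (Grimmett 2006, Thm. (2.24)(c) with
  Thm. (3.8)(b); eq. (2.22)): for an edge set `S`, configurations `ξ ⊆ ζ` of `S` and an increasing
  event `A`, `φ(A | ω ∩ S = ξ) ≤ φ(A | ω ∩ S = ζ)`, stated multiplied out
  (`φ(A ∩ C_ξ) φ(C_ζ) ≤ φ(C_ξ) φ(A ∩ C_ζ)`, `C_η = {ω | ω ∩ S = η}`), so that no positivity
  hypothesis is needed; `rcMeasure_real_cond_anti` is the companion for decreasing events, and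
  `rcMeasure_real_inter_cylinder_le_mul_div` the quotient form "conditionally on any
  configuration `ξ` off a region, an increasing event is at most as likely as conditionally on the
  larger configuration `ζ`" — with `ζ = S ∩ E(G)` (everything outside open, i.e. wired) this is
  the bound "uniformly in the configuration outside of the annulus" of DCS 2012, p. 27.
* `rcMeasure_real_fkg_cond` — **strong positive association** (Grimmett 2006, Thm. (3.8)(b):
  the conditional measures `φ(· | C)` on cylinder events are positively associated): for `C`
  closed under `∩` and `∪` and increasing `A, A'`, `φ(A ∩ C) φ(A' ∩ C) ≤ φ(C) φ(A ∩ A' ∩ C)`;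
  cylinders `C_ξ` are closed under `∩`, `∪` (`inter_mem_cylinder`, `union_mem_cylinder`).
* `rcMeasure_real_upper_inter_lower_cond`, `rcMeasure_real_upper_inter_lower` — an increasing
  and a decreasing event are negatively correlated, also conditionally on a cylinder:
  `φ(A ∩ D ∩ C) φ(C) ≤ φ(A ∩ C) φ(D ∩ C)` and `φ(A ∩ D) ≤ φ(A) φ(D)`.

Everything is proved; there are no new definitions (cylinder events are written out as
`{ω | ω ∩ S = ξ}`). The comparison between *wired sets* `B ⊆ B'` (DCS Thm. 3.1, second item) is
`rcMeasure_real_mono_wired_of_isUpperSet` (`FKIsingAnnulusCrossingProofs.lean`) and the wired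
domain Markov property is in `RandomClusterDomainMarkov.lean`; they are not repeated here.

## References

* G. Grimmett, *The Random-Cluster Model*, Springer (2006): §2.2, eqs. (2.20)–(2.23) and
  Thm. (2.24) (strong positive association ⇔ FKG lattice condition ⇔ monotonic); Thm. (3.8)
  (the random-cluster measure with `q ≥ 1` satisfies them).
* H. Duminil-Copin, S. Smirnov, *Conformal invariance of lattice models*, Clay Math. Proc. 15
  (2012) 213–276 (arXiv:1109.1549): Thm. 3.1 (FKG inequality, comparison between boundary
  conditions), §6.1, proof of Thm. 6.1 (successive conditioning).
* R. Ahlswede, D. E. Daykin, *An inequality for the weights of two families of sets, their unions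
  and intersections*, Z. Wahrsch. Verw. Gebiete 43 (1978) 183–185; Mathlib
  `Mathlib.Combinatorics.SetFamily.FourFunctions` (`four_functions_theorem_univ`).
-/

noncomputable section

open MeasureTheory Finset SimpleGraph

namespace Literature.Probability.LatticeModels

section Finite

variable {V : Type*} [Fintype V] [DecidableEq V] (G : SimpleGraph V) [DecidableRel G.Adj]

/-! ### The measure of an event as a weighted sum of an indicator over all edge sets -/

/-- The random-cluster probability of an event `A` as a sum over the whole lattice of edge sets:
`φ(A) = ∑_ω 1_A(ω) · (w(ω)/Z)`, the weight being extended by `0` off the edge sets of `G`.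
[cite: Grimmett2006, §1.2, eq. (1.2)] -/
theorem rcMeasure_real_eq_sum_indicator_mul {p q : ℝ} (hp : p ∈ Set.Icc (0 : ℝ) 1) (hq : 0 < q)
    (B : Set V) (A : Set (Percolation.BondConfig V)) [DecidablePred (· ∈ A)] :
    (rcMeasure G p q B).real A =
      ∑ ω : Finset (Sym2 V), (if (↑ω : Percolation.BondConfig V) ∈ A then (1 : ℝ) else 0) *
        ((if ω ⊆ G.edgeFinset then rcWeight G p q B ω else 0) / rcPartitionFunction G p q B) := by
  have hfilter : (Finset.univ : Finset (Finset (Sym2 V))).filter (· ⊆ G.edgeFinset) =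
      G.edgeFinset.powerset := by
    ext ω; simp
  rw [rcMeasure_real_apply G hp hq B A, ← hfilter, Finset.sum_filter]
  refine Finset.sum_congr rfl fun ω _ ↦ ?_
  by_cases h₁ : ω ⊆ G.edgeFinset <;> by_cases h₂ : (↑ω : Percolation.BondConfig V) ∈ A <;>
    simp [h₁, h₂]

/-! ### The four-events inequality -/

/-- **Four-events inequality for the random-cluster measure** (Ahlswede–Daykin four functions
theorem for the log-supermodular weights `w = p^{|ω|}(1-p)^{|E∖ω|}q^{k^B(ω)}`, `q ≥ 1`;
Grimmett 2006, Thm. (3.8)(a) with Thm. (2.24)): if `A₁, A₂, A₃, A₄` are events such that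
`ω₁ ∈ A₁` and `ω₂ ∈ A₂` imply `ω₁ ∩ ω₂ ∈ A₃` and `ω₁ ∪ ω₂ ∈ A₄`, then
`φ^B_{G,p,q}(A₁) φ^B_{G,p,q}(A₂) ≤ φ^B_{G,p,q}(A₃) φ^B_{G,p,q}(A₄)` for `0 ≤ p ≤ 1`, `1 ≤ q`.
[cite: Grimmett2006, Thm. (3.8)(a) and Thm. (2.24)] -/
theorem rcMeasure_real_four_events {p q : ℝ} (hp : p ∈ Set.Icc (0 : ℝ) 1) (hq : 1 ≤ q)
    (B : Set V) {A₁ A₂ A₃ A₄ : Set (Percolation.BondConfig V)}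
    (h : ∀ ⦃ω₁⦄, ω₁ ∈ A₁ → ∀ ⦃ω₂⦄, ω₂ ∈ A₂ → ω₁ ∩ ω₂ ∈ A₃ ∧ ω₁ ∪ ω₂ ∈ A₄) :
    (rcMeasure G p q B).real A₁ * (rcMeasure G p q B).real A₂ ≤
      (rcMeasure G p q B).real A₃ * (rcMeasure G p q B).real A₄ := by
  classical
  have hq0 : 0 < q := one_pos.trans_le hq
  have hZ := rcPartitionFunction_pos G hp hq0 B
  -- normalised weights `π = w/Z` on the lattice of all edge sets, indicators `χ A`
  set π : Finset (Sym2 V) → ℝ := fun ω ↦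
    (if ω ⊆ G.edgeFinset then rcWeight G p q B ω else 0) / rcPartitionFunction G p q B with hπ
  set χ : Set (Percolation.BondConfig V) → Finset (Sym2 V) → ℝ := fun A ω ↦
    if (↑ω : Percolation.BondConfig V) ∈ A then 1 else 0 with hχ
  have hπ0 : ∀ ω, 0 ≤ π ω := fun ω ↦ div_nonneg (rcWeight_ite_nonneg G hp hq0.le B ω) hZ.le
  have hχ0 : ∀ A ω, 0 ≤ χ A ω := fun A ω ↦ by
    simp only [hχ]; split_ifs <;> norm_num
  have hπl : ∀ a b, π a * π b ≤ π (a ⊓ b) * π (a ⊔ b) := by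
    intro a b
    simp only [hπ]
    rw [div_mul_div_comm, div_mul_div_comm]
    exact div_le_div_of_nonneg_right (rcWeight_lattice_condition G hp hq B a b) (mul_pos hZ hZ).le
  have hnn : ∀ A, (0 : Finset (Sym2 V) → ℝ) ≤ fun ω ↦ χ A ω * π ω := fun A ω ↦
    mul_nonneg (hχ0 A ω) (hπ0 ω)
  -- the four functions condition
  have hcond : ∀ a b, (χ A₁ a * π a) * (χ A₂ b * π b) ≤
      (χ A₃ (a ⊓ b) * π (a ⊓ b)) * (χ A₄ (a ⊔ b) * π (a ⊔ b)) := by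
    intro a b
    by_cases ha : (↑a : Percolation.BondConfig V) ∈ A₁
    · by_cases hb : (↑b : Percolation.BondConfig V) ∈ A₂
      · obtain ⟨h3, h4⟩ := h ha hb
        have h3' : (↑(a ⊓ b) : Percolation.BondConfig V) ∈ A₃ := by
          rw [Finset.inf_eq_inter, Finset.coe_inter]; exact h3
        have h4' : (↑(a ⊔ b) : Percolation.BondConfig V) ∈ A₄ := by
          rw [Finset.sup_eq_union, Finset.coe_union]; exact h4
        simp only [hχ, if_pos ha, if_pos hb, if_pos h3', if_pos h4', one_mul]
        exact hπl a b
      · have hb0 : χ A₂ b = 0 := by simp [hχ, hb]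
        rw [hb0, zero_mul, mul_zero]
        exact mul_nonneg (hnn A₃ _) (hnn A₄ _)
    · have ha0 : χ A₁ a = 0 := by simp [hχ, ha]
      rw [ha0, zero_mul, zero_mul]
      exact mul_nonneg (hnn A₃ _) (hnn A₄ _)
  have key := four_functions_theorem_univ (fun ω ↦ χ A₁ ω * π ω) (fun ω ↦ χ A₂ ω * π ω)
    (fun ω ↦ χ A₃ ω * π ω) (fun ω ↦ χ A₄ ω * π ω) (hnn A₁) (hnn A₂) (hnn A₃) (hnn A₄) hcond
  rw [rcMeasure_real_eq_sum_indicator_mul G hp hq0 B A₁,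
    rcMeasure_real_eq_sum_indicator_mul G hp hq0 B A₂,
    rcMeasure_real_eq_sum_indicator_mul G hp hq0 B A₃,
    rcMeasure_real_eq_sum_indicator_mul G hp hq0 B A₄]
  exact key

/-! ### Cylinder events -/

/-- Cylinder events are closed under intersection: if `ω₁ ∩ S = ξ` and `ω₂ ∩ S = ξ` then
`(ω₁ ∩ ω₂) ∩ S = ξ`. [folklore] -/
theorem inter_mem_cylinder {E : Type*} {S ξ ω₁ ω₂ : Set E} (h₁ : ω₁ ∩ S = ξ) (h₂ : ω₂ ∩ S = ξ) :
    (ω₁ ∩ ω₂) ∩ S = ξ := by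
  rw [Set.inter_inter_distrib_right, h₁, h₂, Set.inter_self]

/-- Cylinder events are closed under union: if `ω₁ ∩ S = ξ` and `ω₂ ∩ S = ξ` then
`(ω₁ ∪ ω₂) ∩ S = ξ`. [folklore] -/
theorem union_mem_cylinder {E : Type*} {S ξ ω₁ ω₂ : Set E} (h₁ : ω₁ ∩ S = ξ) (h₂ : ω₂ ∩ S = ξ) :
    (ω₁ ∪ ω₂) ∩ S = ξ := by
  rw [Set.union_inter_distrib_right, h₁, h₂, Set.union_self]

/-- Meet and join of two cylinders over the same edge set `S` with comparable configurations
`ξ ⊆ ζ`: `(ω₁ ∩ ω₂) ∩ S = ξ` and `(ω₁ ∪ ω₂) ∩ S = ζ` when `ω₁ ∩ S = ξ`, `ω₂ ∩ S = ζ`. [folklore] -/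
theorem inter_union_mem_cylinder {E : Type*} {S ξ ζ ω₁ ω₂ : Set E} (hξζ : ξ ⊆ ζ)
    (h₁ : ω₁ ∩ S = ξ) (h₂ : ω₂ ∩ S = ζ) :
    (ω₁ ∩ ω₂) ∩ S = ξ ∧ (ω₁ ∪ ω₂) ∩ S = ζ := by
  constructor
  · rw [Set.inter_inter_distrib_right, h₁, h₂, Set.inter_eq_left.2 hξζ]
  · rw [Set.union_inter_distrib_right, h₁, h₂, Set.union_eq_right.2 hξζ]

/-! ### Grimmett's "monotonic": conditional comparison between configurations off a region -/

/-- **The random-cluster measure is monotonic** (Grimmett 2006, eq. (2.22) and Thm. (2.24)(c),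
valid for `φ_{p,q}`, `q ≥ 1`, by Thm. (3.8)(b)): for an edge set `S`, two configurations
`ξ ⊆ ζ` of `S` and an increasing event `A`,
`φ(A | ω ∩ S = ξ) ≤ φ(A | ω ∩ S = ζ)`, here multiplied out as
`φ(A ∩ C_ξ) φ(C_ζ) ≤ φ(C_ξ) φ(A ∩ C_ζ)` with `C_η = {ω | ω ∩ S = η}` (no positivity needed).
With `ζ = S ∩ E(G)` ("all edges of `S` open", the wired configuration off the complement of `S`)
this is the comparison "uniformly in the configuration outside" used by Duminil-Copin–Smirnov
(2012, p. 27) in successive conditionings. [cite: Grimmett2006, Thm. (2.24)(c) and Thm. (3.8)(b)] -/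
theorem rcMeasure_real_cond_mono {p q : ℝ} (hp : p ∈ Set.Icc (0 : ℝ) 1) (hq : 1 ≤ q) (B : Set V)
    (S : Set (Sym2 V)) {ξ ζ : Set (Sym2 V)} (hξζ : ξ ⊆ ζ) {A : Set (Percolation.BondConfig V)}
    (hA : IsUpperSet A) :
    (rcMeasure G p q B).real (A ∩ {ω | ω ∩ S = ξ}) * (rcMeasure G p q B).real {ω | ω ∩ S = ζ} ≤
      (rcMeasure G p q B).real {ω | ω ∩ S = ξ} *
        (rcMeasure G p q B).real (A ∩ {ω | ω ∩ S = ζ}) := by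
  refine rcMeasure_real_four_events G hp hq B fun ω₁ h₁ ω₂ h₂ ↦ ?_
  obtain ⟨h3, h4⟩ := inter_union_mem_cylinder hξζ h₁.2 h₂
  exact ⟨h3, hA Set.subset_union_left h₁.1, h4⟩

/-- **Monotonic, decreasing events** (Grimmett 2006, Thm. (2.24)(c) applied to complements): for
`ζ ⊆ ξ` and a decreasing event `D`, `φ(D | ω ∩ S = ξ) ≤ φ(D | ω ∩ S = ζ)`, multiplied out as
`φ(D ∩ C_ξ) φ(C_ζ) ≤ φ(C_ξ) φ(D ∩ C_ζ)`: conditioning on fewer open edges off the region favours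
decreasing events. [cite: Grimmett2006, Thm. (2.24)(c) and Thm. (3.8)(b)] -/
theorem rcMeasure_real_cond_anti {p q : ℝ} (hp : p ∈ Set.Icc (0 : ℝ) 1) (hq : 1 ≤ q) (B : Set V)
    (S : Set (Sym2 V)) {ξ ζ : Set (Sym2 V)} (hζξ : ζ ⊆ ξ) {D : Set (Percolation.BondConfig V)}
    (hD : IsLowerSet D) :
    (rcMeasure G p q B).real (D ∩ {ω | ω ∩ S = ξ}) * (rcMeasure G p q B).real {ω | ω ∩ S = ζ} ≤
      (rcMeasure G p q B).real {ω | ω ∩ S = ξ} *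
        (rcMeasure G p q B).real (D ∩ {ω | ω ∩ S = ζ}) := by
  rw [mul_comm ((rcMeasure G p q B).real (D ∩ {ω | ω ∩ S = ξ})),
    mul_comm ((rcMeasure G p q B).real {ω | ω ∩ S = ξ})]
  refine rcMeasure_real_four_events G hp hq B fun ω₁ h₁ ω₂ h₂ ↦ ?_
  obtain ⟨h3, h4⟩ := inter_union_mem_cylinder hζξ h₁ h₂.2
  exact ⟨⟨hD Set.inter_subset_right h₂.1, h3⟩, h4⟩

/-- **Quotient form of monotonicity** (Grimmett 2006, eq. (2.22); DCS 2012, p. 27, "bounded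
uniformly on the configuration outside of the annulus"): if the larger cylinder `C_ζ` has positive
probability, then for every `ξ ⊆ ζ` and every increasing `A`,
`φ(A ∩ C_ξ) ≤ φ(C_ξ) · (φ(A ∩ C_ζ) / φ(C_ζ))` — the conditional probability given *any* smaller
configuration off the region is bounded by the one given `ζ` (e.g. `ζ = S ∩ E(G)`, everything off
the region open). [cite: Grimmett2006, eq. (2.22) and Thm. (3.8)(b)] -/
theorem rcMeasure_real_inter_cylinder_le_mul_div {p q : ℝ} (hp : p ∈ Set.Icc (0 : ℝ) 1) (hq : 1 ≤ q)
    (B : Set V) (S : Set (Sym2 V)) {ξ ζ : Set (Sym2 V)} (hξζ : ξ ⊆ ζ)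
    {A : Set (Percolation.BondConfig V)} (hA : IsUpperSet A)
    (hζ : 0 < (rcMeasure G p q B).real {ω | ω ∩ S = ζ}) :
    (rcMeasure G p q B).real (A ∩ {ω | ω ∩ S = ξ}) ≤
      (rcMeasure G p q B).real {ω | ω ∩ S = ξ} *
        ((rcMeasure G p q B).real (A ∩ {ω | ω ∩ S = ζ}) / (rcMeasure G p q B).real {ω | ω ∩ S = ζ}) := by
  rw [mul_div_assoc', le_div_iff₀ hζ]
  exact rcMeasure_real_cond_mono G hp hq B S hξζ hA

/-! ### Strong positive association: FKG conditionally on a cylinder -/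

/-- **Strong positive association of the random-cluster measure** (Grimmett 2006, Thm. (3.8)(b)
with §2.2 (2.21): for `q ≥ 1` every conditional measure `φ(· | C)` on a cylinder event is
positively associated): if `C` is closed under `∩` and `∪` (e.g. `C = {ω | ω ∩ S = ξ}`,
`inter_mem_cylinder`, `union_mem_cylinder`) and `A, A'` are increasing, then
`φ(A ∩ C) φ(A' ∩ C) ≤ φ(C) φ(A ∩ A' ∩ C)`, i.e. `φ(A | C) φ(A' | C) ≤ φ(A ∩ A' | C)`.
[cite: Grimmett2006, Thm. (3.8)(b)] -/
theorem rcMeasure_real_fkg_cond {p q : ℝ} (hp : p ∈ Set.Icc (0 : ℝ) 1) (hq : 1 ≤ q) (B : Set V)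
    {C A A' : Set (Percolation.BondConfig V)}
    (hC : ∀ ⦃ω₁⦄, ω₁ ∈ C → ∀ ⦃ω₂⦄, ω₂ ∈ C → ω₁ ∩ ω₂ ∈ C ∧ ω₁ ∪ ω₂ ∈ C)
    (hA : IsUpperSet A) (hA' : IsUpperSet A') :
    (rcMeasure G p q B).real (A ∩ C) * (rcMeasure G p q B).real (A' ∩ C) ≤
      (rcMeasure G p q B).real C * (rcMeasure G p q B).real (A ∩ A' ∩ C) := by
  refine rcMeasure_real_four_events G hp hq B fun ω₁ h₁ ω₂ h₂ ↦ ?_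
  obtain ⟨h3, h4⟩ := hC h₁.2 h₂.2
  exact ⟨h3, ⟨hA Set.subset_union_left h₁.1, hA' Set.subset_union_right h₂.1⟩, h4⟩

/-- **FKG conditionally on the configuration off a region** (Grimmett 2006, Thm. (3.8)(b)): for an
edge set `S`, a configuration `ξ` of `S` and increasing `A, A'`,
`φ(A ∩ C_ξ) φ(A' ∩ C_ξ) ≤ φ(C_ξ) φ(A ∩ A' ∩ C_ξ)` with `C_ξ = {ω | ω ∩ S = ξ}`.
[cite: Grimmett2006, Thm. (3.8)(b)] -/
theorem rcMeasure_real_fkg_cylinder {p q : ℝ} (hp : p ∈ Set.Icc (0 : ℝ) 1) (hq : 1 ≤ q) (B : Set V)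
    (S ξ : Set (Sym2 V)) {A A' : Set (Percolation.BondConfig V)} (hA : IsUpperSet A)
    (hA' : IsUpperSet A') :
    (rcMeasure G p q B).real (A ∩ {ω | ω ∩ S = ξ}) * (rcMeasure G p q B).real (A' ∩ {ω | ω ∩ S = ξ}) ≤
      (rcMeasure G p q B).real {ω | ω ∩ S = ξ} *
        (rcMeasure G p q B).real (A ∩ A' ∩ {ω | ω ∩ S = ξ}) :=
  rcMeasure_real_fkg_cond G hp hq B
    (fun _ h₁ _ h₂ ↦ ⟨inter_mem_cylinder h₁ h₂, union_mem_cylinder h₁ h₂⟩) hA hA'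

/-! ### Increasing versus decreasing events -/

/-- **An increasing and a decreasing event are negatively correlated, conditionally on a
cylinder** (from strong positive association, Grimmett 2006, Thm. (3.8)(b)): for `C` closed under
`∩` and `∪`, `A` increasing and `D` decreasing, `φ(A ∩ D ∩ C) φ(C) ≤ φ(A ∩ C) φ(D ∩ C)`, i.e.
`φ(A | D ∩ C) ≤ φ(A | C)`: conditioning in addition on a decreasing event lowers increasing ones.
This is the step "`φ¹(crossing | the explored frontier is closed) ≤ φ¹(crossing)`" of successive
conditioning arguments (DCS 2012, §6.1). [cite: Grimmett2006, Thm. (3.8)(b)] -/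
theorem rcMeasure_real_upper_inter_lower_cond {p q : ℝ} (hp : p ∈ Set.Icc (0 : ℝ) 1) (hq : 1 ≤ q)
    (B : Set V) {C A D : Set (Percolation.BondConfig V)}
    (hC : ∀ ⦃ω₁⦄, ω₁ ∈ C → ∀ ⦃ω₂⦄, ω₂ ∈ C → ω₁ ∩ ω₂ ∈ C ∧ ω₁ ∪ ω₂ ∈ C)
    (hA : IsUpperSet A) (hD : IsLowerSet D) :
    (rcMeasure G p q B).real (A ∩ D ∩ C) * (rcMeasure G p q B).real C ≤
      (rcMeasure G p q B).real (A ∩ C) * (rcMeasure G p q B).real (D ∩ C) := by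
  rw [mul_comm ((rcMeasure G p q B).real (A ∩ C))]
  refine rcMeasure_real_four_events G hp hq B fun ω₁ h₁ ω₂ h₂ ↦ ?_
  obtain ⟨h3, h4⟩ := hC h₁.2 h₂
  exact ⟨⟨hD Set.inter_subset_left h₁.1.2, h3⟩, hA Set.subset_union_left h₁.1.1, h4⟩

/-- **An increasing and a decreasing event are negatively correlated** under `φ^B_{G,p,q}`,
`q ≥ 1`: `φ(A ∩ D) ≤ φ(A) φ(D)` (the FKG inequality, Grimmett 2006, Thm. (3.8)(b), applied to `A`
and the increasing event `Dᶜ`). [cite: Grimmett2006, Thm. (3.8)(b)] -/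
theorem rcMeasure_real_upper_inter_lower {p q : ℝ} (hp : p ∈ Set.Icc (0 : ℝ) 1) (hq : 1 ≤ q)
    (B : Set V) {A D : Set (Percolation.BondConfig V)} (hA : IsUpperSet A) (hD : IsLowerSet D) :
    (rcMeasure G p q B).real (A ∩ D) ≤ (rcMeasure G p q B).real A * (rcMeasure G p q B).real D := by
  haveI := isProbabilityMeasure_rcMeasure G hp (one_pos.trans_le hq) B
  have h := rcMeasure_real_upper_inter_lower_cond G hp hq B (C := Set.univ) (A := A) (D := D)
    (fun _ _ _ _ ↦ ⟨Set.mem_univ _, Set.mem_univ _⟩) hA hD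
  simpa only [Set.inter_univ, probReal_univ, mul_one] using h

end Finite

end Literature.Probability.LatticeModels

end
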